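import Literature.Geometry.Lorentzian.KerrGKSTrappingRegion
import HarnessLib

/-!
# The GKS trapping collar `{|𝒯| ≤ r³/10}` in exact Kerr: horizon, `2M`, `5M/2`, and the radial
# quartic `3Mr⁴ − 4a²r³ + Ma⁴` of GKS Remark 3.8.11 (kernel certificates for the `|a| ≪ M` census)

(family `gr`; namespace `Literature.Geometry.Lorentzian.Kerr`; continues `KerrGKSTrappingRegion.lean`,
which defines the Giorgi–Klainerman–Szeftel cubic `𝒯(r) = r³ − 3Mr² + a²r + Ma²`
(`Kerr.gksTrapping`) and proves that the photon shell lies in `{|𝒯| ≤ r³/10}` exactly up to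
`|a| ≈ 0.2472 M`; uses `Kerr.rPlus M a = M + √(M² − a²)` from `KerrSchild.lean`.)

Source: E. Giorgi, S. Klainerman, J. Szeftel, *Wave equations estimates and the nonlinear stability
of slowly rotating Kerr black holes*, arXiv:2205.14808 = Pure Appl. Math. Q. (2024). Three printed
items of that paper in which the smallness of `a/m` is invoked or a claim is made "for all
`0 ≤ γ ≤ 1`" are quantified here by elementary real algebra:

1. **Lemma 6.1.12** (TeX l.9845–9859; PAMQ p. 216): "For `|a|/m` sufficiently small and
   `δ_trap = 1/10`, the vectorfield `T` is strictly timelike in `𝓜_trap`", proved from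
   "`𝓜_trap = [r̃₋, r̃₊]` … `r̃± = (3/(1 ∓ δ_trap) + O(γ))m` … we have clearly `r̃₋ > 5m/2` for `γ` small
   enough" (`γ = a²/m²`). Here: `𝒯(r₊) = −2M r₊ √(M² − a²)` (`gksTrapping_rPlus`); the radius `r = 2M`
   is never in the collar for `|a| ≤ M` (`two_mul_not_mem_gksCollar`: `|𝒯(2M)| > (2M)³/10`); the
   radius `5M/2` is in the collar iff `25/56 ≤ a²/M² ≤ 75/56` (`five_halves_mem_gksCollar_iff`), so
   "`r̃₋ > 5m/2` for `γ` small enough" means precisely `γ < 25/56` (`|a|/M < 0.66815…`); and the horizon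
   itself is outside the collar for `|a| ≤ 0.998 M` but inside it at extremality
   (`rPlus_not_mem_gksCollar`, `gksTrapping_rPlus_of_abs_eq`) — the collar acquires a second,
   near-horizon component only for `|a|/M > 0.9984…`.
2. **Remark 3.8.11** (TeX l.7026–7044; PAMQ p. 153): the radial quartic
   `Q(r) = 3mr⁴ − 4a²r³ + ma⁴`, numerator of `∂_r(𝒯/(r(r² − a²)))` (`gksRadialQuartic_eq_numerator`),
   "is positive for `x ≥ 1` and `0 ≤ γ ≤ 1`" (`r = r₊ x`). Here: the Taylor expansion of `Q` at `r₊`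
   has non-negative coefficients (`gksRadialQuartic_expand`), so `Q ≥ 0` on `r ≥ r₊` for all `|a| ≤ M`
   (`gksRadialQuartic_nonneg`, the form used at TeX l.11162 "≥ 0 … in the range `|a|/m ≤ 1`"),
   `Q > 0` there when `|a| < M` (`gksRadialQuartic_pos`), and `Q(r₊) = 0` exactly in the extremal case
   (`gksRadialQuartic_self_of_extremal`: the printed "positive … `0 ≤ γ ≤ 1`" over-states the single
   point `(x, γ) = (1, 1)`).
3. **Footnote to TeX l.11163** (PAMQ p. 241): "`(3mr⁴ − 4a²r³ + ma⁴)/(r² − a²)² |_(r = r₊)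
   = m(2(3 − 2γ) + (6 − γ)√(1 − γ))/(1 + √(1 − γ))²`, `γ = |a|/m`" — with `γ = a²/m²` both sides
   equal `m(2 + √(1 − γ)) = 2M + √(M² − a²)` (`gksRadialQuartic_rPlus`,
   `gksRadialQuartic_rPlus_div`, `footnote_rhs_eq`); as printed (`γ = |a|/m`) the identity is a typo.

Nothing here bears on the validity of the GKS estimates; these are the exact-Kerr facts behind three
"small `a`" sentences, for the census of the `|a| ≪ M` dependence (Final-State-Conjecture literature
audit).

## References
* E. Giorgi, S. Klainerman, J. Szeftel, arXiv:2205.14808; Pure Appl. Math. Q. (2024),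
  doi:10.4310/pamq.241128023033 — Def. 6.1.9, Lemma 6.1.12, Remark 3.8.11, §7.1 footnote
  (key `GiorgiKlainermanSzeftel2022`).
-/

noncomputable section

namespace Literature.Geometry.Lorentzian

namespace Kerr

open Real

/-! ### The collar at the horizon, at `2M` and at `5M/2` (Lemma 6.1.12) -/

/-- `𝒯(r₊) = −2M r₊ √(M² − a²)` for `|a| ≤ M` (so `𝒯(r₊) < 0` off extremality and `= 0` at
extremality). [cite: GiorgiKlainermanSzeftel2022, Def. 6.1.9 and Lemma 6.1.12] -/
theorem gksTrapping_rPlus {M a : ℝ} (ha : |a| ≤ M) :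
    gksTrapping M a (rPlus M a) = -2 * M * rPlus M a * √(M ^ 2 - a ^ 2) := by
  have ha2 : a ^ 2 ≤ M ^ 2 := by
    rw [← sq_abs]; exact pow_le_pow_left₀ (abs_nonneg a) ha 2
  have hd : √(M ^ 2 - a ^ 2) ^ 2 = M ^ 2 - a ^ 2 := Real.sq_sqrt (by linarith)
  simp only [gksTrapping, rPlus]
  linear_combination ((M + √(M ^ 2 - a ^ 2)) + M) * hd

/-- At extremality `|a| = M` the horizon `r₊ = M` lies IN the collar: `𝒯(r₊) = 0`.
[cite: GiorgiKlainermanSzeftel2022, Def. 6.1.9] -/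
theorem gksTrapping_rPlus_of_abs_eq {M a : ℝ} (ha : |a| = M) : gksTrapping M a (rPlus M a) = 0 := by
  rw [gksTrapping_rPlus ha.le]
  have : M ^ 2 - a ^ 2 = 0 := by rw [← ha, sq_abs]; ring
  rw [this, Real.sqrt_zero]; ring

/-- **The horizon is outside the collar for `|a| ≤ 0.998 M`**: `|𝒯(r₊)| > r₊³/10`
(`|𝒯(r₊)|/r₊³ = 2M√(M² − a²)/r₊²`, and `20M√(M² − a²) > r₊²` as soon as `√(M² − a²) > M/17`).
The collar has a second, near-horizon component only for `|a|/M > 0.99844…`.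
[cite: GiorgiKlainermanSzeftel2022, Lemma 6.1.12] -/
theorem rPlus_not_mem_gksCollar {M a : ℝ} (hM : 0 < M) (ha : |a| ≤ 998 / 1000 * M) :
    rPlus M a ^ 3 / 10 < |gksTrapping M a (rPlus M a)| := by
  have haM : |a| ≤ M := ha.trans (by linarith)
  have ha2 : a ^ 2 ≤ (998 / 1000 * M) ^ 2 := by
    rw [← sq_abs]; exact pow_le_pow_left₀ (abs_nonneg a) ha 2
  have hMa : 0 ≤ M ^ 2 - a ^ 2 := by nlinarith
  rw [gksTrapping_rPlus haM]
  simp only [rPlus]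
  set d := √(M ^ 2 - a ^ 2) with hd_def
  have hd0 : 0 ≤ d := Real.sqrt_nonneg _
  have hd2 : d ^ 2 = M ^ 2 - a ^ 2 := Real.sq_sqrt hMa
  have hdM : d ≤ M := by nlinarith
  have hd1 : 63 / 1000 * M ≤ d := by nlinarith
  have hMd : 0 < M + d := by positivity
  rw [show -2 * M * (M + d) * d = -(2 * M * (M + d) * d) by ring, abs_neg,
    abs_of_nonneg (by positivity)]
  have hsq : (M + d) ^ 2 ≤ M ^ 2 + 3 * M * d := by nlinarith
  have hcube : (M + d) ^ 3 ≤ (M + d) * (M ^ 2 + 3 * M * d) := by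
    rw [pow_succ']
    exact mul_le_mul_of_nonneg_left hsq hMd.le
  have hneg : (M + d) * (M * (M - 17 * d)) < 0 :=
    mul_neg_of_pos_of_neg hMd (mul_neg_of_pos_of_neg hM (by linarith))
  nlinarith [hcube, hneg]

/-- `𝒯(2M) = −4M³ + 3Ma²`. [cite: GiorgiKlainermanSzeftel2022, Def. 6.1.9] -/
theorem gksTrapping_two_mul (M a : ℝ) : gksTrapping M a (2 * M) = -4 * M ^ 3 + 3 * M * a ^ 2 := by
  simp [gksTrapping]; ring

/-- **`r = 2M` is never in the collar** (`|a| ≤ M`, `0 < M`): `|𝒯(2M)| ≥ M³ > (2M)³/10`; in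
Lemma 6.1.12's notation `r̃₋ > 2m` for every `0 ≤ γ ≤ 1` (no smallness needed for this part).
[cite: GiorgiKlainermanSzeftel2022, Lemma 6.1.12] -/
theorem two_mul_not_mem_gksCollar {M a : ℝ} (hM : 0 < M) (ha : |a| ≤ M) :
    (2 * M) ^ 3 / 10 < |gksTrapping M a (2 * M)| := by
  have ha2 : a ^ 2 ≤ M ^ 2 := by
    rw [← sq_abs]; exact pow_le_pow_left₀ (abs_nonneg a) ha 2
  rw [gksTrapping_two_mul, show -4 * M ^ 3 + 3 * M * a ^ 2 = -(4 * M ^ 3 - 3 * M * a ^ 2) by ring,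
    abs_neg, abs_of_nonneg (by nlinarith [mul_pos hM hM])]
  nlinarith [mul_pos hM hM, pow_pos hM 3]

/-- `𝒯(5M/2) = −(25/8)M³ + (7/2)Ma²`. [cite: GiorgiKlainermanSzeftel2022, Def. 6.1.9] -/
theorem gksTrapping_five_halves (M a : ℝ) :
    gksTrapping M a (5 / 2 * M) = -(25 / 8) * M ^ 3 + 7 / 2 * M * a ^ 2 := by
  simp [gksTrapping]; ring

/-- **`r = 5M/2` is in the collar iff `25/56 ≤ a²/M² ≤ 75/56`** (`0 < M`; for `|a| ≤ M` the upper
bound is automatic). Hence Lemma 6.1.12's "`r̃₋ > 5m/2` for `γ` small enough" holds precisely for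
`γ = a²/m² < 25/56`, i.e. `|a|/m < 0.66815…`. [cite: GiorgiKlainermanSzeftel2022, Lemma 6.1.12] -/
theorem five_halves_mem_gksCollar_iff {M a : ℝ} (hM : 0 < M) :
    |gksTrapping M a (5 / 2 * M)| ≤ (5 / 2 * M) ^ 3 / 10 ↔
      25 / 56 * M ^ 2 ≤ a ^ 2 ∧ a ^ 2 ≤ 75 / 56 * M ^ 2 := by
  rw [gksTrapping_five_halves, abs_le]
  have hM3 : 0 < M ^ 3 := pow_pos hM 3
  constructor
  · rintro ⟨h1, h2⟩
    constructor <;> nlinarith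
  · rintro ⟨h1, h2⟩
    constructor <;> nlinarith

/-! ### The radial quartic of Remark 3.8.11 -/

/-- The **radial quartic** `Q(r) = 3Mr⁴ − 4a²r³ + Ma⁴` of GKS Remark 3.8.11 (also §7.1, TeX l.11162).
[cite: GiorgiKlainermanSzeftel2022, Remark 3.8.11] -/
def gksRadialQuartic (M a r : ℝ) : ℝ :=
  3 * M * r ^ 4 - 4 * a ^ 2 * r ^ 3 + M * a ^ 4

/-- Unfolding lemma. [cite: GiorgiKlainermanSzeftel2022, Remark 3.8.11] -/
theorem gksRadialQuartic_def (M a r : ℝ) :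
    gksRadialQuartic M a r = 3 * M * r ^ 4 - 4 * a ^ 2 * r ^ 3 + M * a ^ 4 := rfl

/-- **`Q` is the numerator of `∂_r(𝒯/(r(r² − a²)))`**: `Q = 𝒯′·r(r² − a²) − 𝒯·(3r² − a²)` with
`𝒯′ = 3r² − 6Mr + a²` (Remark 3.8.11: `ℛ̃″ = −2∂_r(𝒯/(r(r² − a²)))κ² = −2Q/(r²(r² − a²)²)κ²`).
[cite: GiorgiKlainermanSzeftel2022, Remark 3.8.11] -/
theorem gksRadialQuartic_eq_numerator (M a r : ℝ) :
    gksRadialQuartic M a r =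
      (3 * r ^ 2 - 6 * M * r + a ^ 2) * (r * (r ^ 2 - a ^ 2))
        - gksTrapping M a r * (3 * r ^ 2 - a ^ 2) := by
  simp only [gksRadialQuartic, gksTrapping]; ring

/-- **Taylor expansion of `Q` at the horizon with non-negative coefficients**: writing
`d = √(M² − a²)`, `r₊ = M + d`, `r = r₊ + u`,
`Q(r) = 4d²r₊²(2M + d) + 12d r₊³u + 6r₊(M² + 3Md + 2d²)u² + 4(2M² + 3Md + d²)u³ + 3Mu⁴`.
[cite: GiorgiKlainermanSzeftel2022, Remark 3.8.11] -/
theorem gksRadialQuartic_expand {M a : ℝ} (ha : |a| ≤ M) (u : ℝ) :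
    gksRadialQuartic M a (rPlus M a + u) =
      4 * (M ^ 2 - a ^ 2) * rPlus M a ^ 2 * (2 * M + √(M ^ 2 - a ^ 2))
      + 12 * √(M ^ 2 - a ^ 2) * rPlus M a ^ 3 * u
      + 6 * rPlus M a * (M ^ 2 + 3 * M * √(M ^ 2 - a ^ 2) + 2 * (M ^ 2 - a ^ 2)) * u ^ 2
      + 4 * (2 * M ^ 2 + 3 * M * √(M ^ 2 - a ^ 2) + (M ^ 2 - a ^ 2)) * u ^ 3
      + 3 * M * u ^ 4 := by
  have ha2 : a ^ 2 ≤ M ^ 2 := by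
    rw [← sq_abs]; exact pow_le_pow_left₀ (abs_nonneg a) ha 2
  have hd : √(M ^ 2 - a ^ 2) ^ 2 = M ^ 2 - a ^ 2 := Real.sq_sqrt (by linarith)
  simp only [gksRadialQuartic, rPlus]
  linear_combination (M * a ^ 2 + M * (M ^ 2 - √(M ^ 2 - a ^ 2) ^ 2)
    - 4 * (M + √(M ^ 2 - a ^ 2) + u) ^ 3
    + 4 * (M + √(M ^ 2 - a ^ 2)) ^ 2 * (2 * M + √(M ^ 2 - a ^ 2))
    + 12 * (M + √(M ^ 2 - a ^ 2)) * u ^ 2 + 4 * u ^ 3) * hd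

/-- `Q(r₊) = 4(M² − a²) r₊² (2M + √(M² − a²))`. [cite: GiorgiKlainermanSzeftel2022, Remark 3.8.11] -/
theorem gksRadialQuartic_rPlus {M a : ℝ} (ha : |a| ≤ M) :
    gksRadialQuartic M a (rPlus M a) =
      4 * (M ^ 2 - a ^ 2) * rPlus M a ^ 2 * (2 * M + √(M ^ 2 - a ^ 2)) := by
  have h := gksRadialQuartic_expand ha 0
  simp only [add_zero, mul_zero, zero_pow two_ne_zero, zero_pow three_ne_zero,
    zero_pow four_ne_zero] at h
  linarith

/-- **`Q ≥ 0` on `r ≥ r₊` for ALL `|a| ≤ M`, `0 ≤ M`** (the form used at TeX l.11162: "the polynomial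
`3mr⁴ − 4a²r³ + ma⁴ ≥ 0` for all values of `r ≥ r₊` in the range `|a|/m ≤ 1`").
[cite: GiorgiKlainermanSzeftel2022, Remark 3.8.11] -/
theorem gksRadialQuartic_nonneg {M a r : ℝ} (hM : 0 ≤ M) (ha : |a| ≤ M) (hr : rPlus M a ≤ r) :
    0 ≤ gksRadialQuartic M a r := by
  obtain ⟨u, hu, rfl⟩ : ∃ u, 0 ≤ u ∧ r = rPlus M a + u := ⟨r - rPlus M a, by linarith, by ring⟩
  have ha2 : a ^ 2 ≤ M ^ 2 := by
    rw [← sq_abs]; exact pow_le_pow_left₀ (abs_nonneg a) ha 2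
  have hMa : 0 ≤ M ^ 2 - a ^ 2 := by linarith
  have hr0 : 0 ≤ rPlus M a := by unfold rPlus; positivity
  rw [gksRadialQuartic_expand ha u]
  set d := √(M ^ 2 - a ^ 2) with hd_def
  set R := rPlus M a with hR_def
  set D := M ^ 2 - a ^ 2 with hD_def
  have hd0 : 0 ≤ d := Real.sqrt_nonneg _
  positivity

/-- **`Q > 0` on `r ≥ r₊` in the sub-extremal range `|a| < M`** (Remark 3.8.11: "negative [`ℛ̃″`] in
the exterior region in the full sub-extremal range `|a| < m`").
[cite: GiorgiKlainermanSzeftel2022, Remark 3.8.11] -/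
theorem gksRadialQuartic_pos {M a r : ℝ} (ha : |a| < M) (hr : rPlus M a ≤ r) :
    0 < gksRadialQuartic M a r := by
  have hM : 0 < M := lt_of_le_of_lt (abs_nonneg a) ha
  obtain ⟨u, hu, rfl⟩ : ∃ u, 0 ≤ u ∧ r = rPlus M a + u := ⟨r - rPlus M a, by linarith, by ring⟩
  have ha2 : a ^ 2 < M ^ 2 := by
    rw [← sq_abs]; exact pow_lt_pow_left₀ ha (abs_nonneg a) two_ne_zero
  have hMa : 0 < M ^ 2 - a ^ 2 := by linarith
  have hr0 : 0 < rPlus M a := by unfold rPlus; positivity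
  rw [gksRadialQuartic_expand ha.le u]
  set d := √(M ^ 2 - a ^ 2) with hd_def
  set R := rPlus M a with hR_def
  set D := M ^ 2 - a ^ 2 with hD_def
  have hd0 : 0 ≤ d := Real.sqrt_nonneg _
  positivity

/-- **The extremal corner**: for `|a| = M` (`r₊ = M`), `Q(r₊) = 3M⁵ − 4M⁵ + M⁵ = 0` — so the printed
"positive for `x ≥ 1` and `0 ≤ γ ≤ 1`" of Remark 3.8.11 fails exactly at `(x, γ) = (1, 1)` and holds
otherwise (`gksRadialQuartic_pos`, and `u > 0` terms of `gksRadialQuartic_expand`).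
[cite: GiorgiKlainermanSzeftel2022, Remark 3.8.11] -/
theorem gksRadialQuartic_self_of_extremal {M a : ℝ} (ha : |a| = M) :
    gksRadialQuartic M a (rPlus M a) = 0 := by
  have hM2 : M ^ 2 - a ^ 2 = 0 := by rw [← ha, sq_abs]; ring
  have hr : rPlus M a = M := by unfold rPlus; rw [hM2, Real.sqrt_zero, add_zero]
  have ha2 : a ^ 2 = M ^ 2 := by linarith
  have ha4 : a ^ 4 = M ^ 4 := by linear_combination (a ^ 2 + M ^ 2) * ha2
  simp only [gksRadialQuartic, hr, ha4, ha2]; ring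

/-! ### The footnote at the horizon (`γ = a²/m²`) -/

/-- `r₊² − a² = 2 r₊ √(M² − a²)` for `|a| ≤ M`. [folklore] -/
theorem rPlus_sq_sub_sq {M a : ℝ} (ha : |a| ≤ M) :
    rPlus M a ^ 2 - a ^ 2 = 2 * rPlus M a * √(M ^ 2 - a ^ 2) := by
  have ha2 : a ^ 2 ≤ M ^ 2 := by
    rw [← sq_abs]; exact pow_le_pow_left₀ (abs_nonneg a) ha 2
  have hd : √(M ^ 2 - a ^ 2) ^ 2 = M ^ 2 - a ^ 2 := Real.sq_sqrt (by linarith)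
  simp only [rPlus]
  linear_combination (-1 : ℝ) * hd

/-- **The footnote identity with `γ = a²/m²`**: for `|a| < M`,
`Q(r₊)/(r₊² − a²)² = 2M + √(M² − a²) = M(2 + √(1 − a²/M²))`.
[cite: GiorgiKlainermanSzeftel2022, §7.1 footnote (TeX l.11163)] -/
theorem gksRadialQuartic_rPlus_div {M a : ℝ} (ha : |a| < M) :
    gksRadialQuartic M a (rPlus M a) / (rPlus M a ^ 2 - a ^ 2) ^ 2 = 2 * M + √(M ^ 2 - a ^ 2) := by
  have hM : 0 < M := lt_of_le_of_lt (abs_nonneg a) ha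
  have ha2 : a ^ 2 < M ^ 2 := by
    rw [← sq_abs]; exact pow_lt_pow_left₀ ha (abs_nonneg a) two_ne_zero
  have hd0 : 0 < √(M ^ 2 - a ^ 2) := Real.sqrt_pos.2 (by linarith)
  have hr0 : 0 < rPlus M a := by unfold rPlus; positivity
  have hne : (rPlus M a ^ 2 - a ^ 2) ^ 2 ≠ 0 := by
    rw [rPlus_sq_sub_sq ha.le]; positivity
  rw [div_eq_iff hne, gksRadialQuartic_rPlus ha.le, rPlus_sq_sub_sq ha.le]
  have hd : √(M ^ 2 - a ^ 2) ^ 2 = M ^ 2 - a ^ 2 := Real.sq_sqrt (by linarith)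
  linear_combination (-(4 * rPlus M a ^ 2 * (2 * M + √(M ^ 2 - a ^ 2)))) * hd

/-- **The printed right-hand side, read with `γ = a²/m²`, is the same number**: for `0 ≤ s`
(`s = √(1 − γ)`, so `γ = 1 − s²`), `(2(3 − 2γ) + (6 − γ)s)/(1 + s)² = 2 + s`. With `γ = |a|/m` (as
printed) the two sides of the footnote differ — a typo, immaterial to the positivity it supports.
[cite: GiorgiKlainermanSzeftel2022, §7.1 footnote (TeX l.11163)] -/
theorem footnote_rhs_eq {s : ℝ} (hs : 0 ≤ s) :
    (2 * (3 - 2 * (1 - s ^ 2)) + (6 - (1 - s ^ 2)) * s) / (1 + s) ^ 2 = 2 + s := by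
  have h1 : (1 + s) ^ 2 ≠ 0 := by positivity
  rw [div_eq_iff h1]; ring

end Kerr

end Literature.Geometry.Lorentzian

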